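import Summits.ResolutionOfSingularities.ResolutionOfSingularities.Theorems.HilbertSamuelEliminationCampaignW42TertiaryCompactnessGeneral
import Summits.ResolutionOfSingularities.ResolutionOfSingularities.Theorems.HilbertSamuelEliminationCampaignW42TertiaryThreefolds
import HarnessLib

/-!
# [OURS · L1 W4.2] Arbitrary maximal strata: «no closed point of `X(ν)` starts an infinite near chain along `S(X, ν)`»
# + the lower-dimensional answers ⇒ `S(X, ν)` is a `ν`-elimination ⇒ `ν`-modification; for threefolds, with CJS
# Thm. 1.2, this is the WHOLE `ν`-modification engine of Corridor3 modulo the pointwise O2-type statement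
# (`--supports stmt-ResolutionOfSingularities-17846`; calibration against stmt-…-19249 / stmt-…-18506)

OURS (slot W4.2 of cell res-hironaka, LADDER-RESOLUTION rung L, D-0089; prover seat res-L1-s42-pv-2, gen 2); NOT
statements of H. Hironaka's manuscript [Hironaka2017]; nothing of the manuscript is used or asserted. AI review is
weaker than expert review. Pure PROOF file; no new definition — the O2-type hypothesis for a non-isolated stratum is
spelled inline: `∀ x ∈ X(ν), IsClosed {x} → NoNearChainFrom R N ν (MarkedStage.init X x) ⊤` («no infinite sequence
of closed points `x_n ∈ X_n(ν)` with `x_{n+1}` above `x_n`», CJS p. 107, from EVERY closed point of the stratum; at an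
isolated origin it is the instance of the OURS statement `TertiaryTermination p`).

* `stateGood_init_general`, `canonicalCentres_general` — for a reduced `X` of finite type over `k`, `dim X ≤ N`,
  `ν ≠ Φ^{(N)}` maximal, and ANY admissible oracle: every canonical run of `S(X, ν)` has regular, permissible centres in
  the strata (the cycle invariant of the Cycles file, p485148, needs no isolation).
* `canonicalSequenceTerminates_of_forall_noNearChain` — pointwise no-infinite-near-chain at the closed points of
  `X(ν)` + the oracle's answers on the strata ⇒ `S(X, ν)` terminates (compactness for arbitrary strata, p486086;
  liveness, p481807).
* `nuMod_of_forall_noNearChain` — … ⇒ `TameWild.NuMod X N d ν` (the canonical run is a `ν`-elimination, CJS Def. 6.14).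
* `answers_of_dim_le_three_general`, `nuMod_threefold_of_forall_noNearChain`, `nuMod_threefold_of_noNearChains` —
  DIMENSION THREE with CJS Thm. 1.2 (`CossartJannsenSaito2020SequencePermissible`, named fact): for `Y` reduced of
  finite type over ANY field, `dim Y ≤ 3`, `dim Y ≤ N`, `dim Y ≤ d`, `ν ≠ Φ^{(N)}` maximal — with NO condition on the
  shape or position of `Y(ν)`, NO tameness, NO perfectness — `TameWild.NuMod Y N d ν` follows from the pointwise
  O2-type statement for the admissible functional oracles answering on resolvable schemes. This covers uniformly the
  conclusions of line tame_wild's `stub_isolatedNu3` (Cossart–Piltant), `stub_tameNu3` (THOR₄ transfer) and the open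
  core `stub_wildNu3` / `stub_confinedWildNu3`: modulo CJS Thm. 1.2, THE `ν`-MODIFICATION ENGINE OF CORRIDOR3 IS EXACTLY
  THE O2-TYPE TERMINATION STATEMENT at the closed points of maximal strata of threefolds (and their blow-ups).

HONEST STATUS: conditional on the named fact `CossartJannsenSaito2020SequencePermissible` (dimension-three theorems only)
and on the inline O2-type hypothesis (OPEN — it contains O2 at `ē = 3`); no other input.

## References

* V. Cossart, U. Jannsen, S. Saito, LNM 2270 (2020), Thm. 1.2, Def. 6.14, Rem. 6.29 (1), p. 92, p. 105, p. 107.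
  [CossartJannsenSaito2020]
* route file Theses/HilbertSamuelElimination.lean (stmt-…-19249, stmt-…-18506); L/res-L1-w42-lead-1/tame_wild_current.lean.
-/

noncomputable section

set_option linter.dupNamespace false -- mandated namespace of this single-conjunct summit

open CategoryTheory AlgebraicGeometry TopologicalSpace Topology IsLocalRing

namespace Summit.ResolutionOfSingularities.ResolutionOfSingularities.Theorems

namespace CampaignW42

open Literature.AlgebraicGeometry.Resolution Literature.RingTheory.HilbertSamuel
open Summit.ResolutionOfSingularities.ResolutionOfSingularities.Theorems.SigmaMaxModificationsCorridor3

universe u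

variable {R : ∀ S : Scheme.{u}, CentreSeq S → Prop} {N : ℕ} {ν : ℕ → ℕ}
variable {k : Type u} [Field k]

/-! ## Good initial state and sound centres for an arbitrary maximal stratum -/

/-- **The canonical centres of `S(X, ν)` are regular, permissible and in the strata — arbitrary maximal stratum,
every admissible oracle** (`X` reduced of finite type over `k`, `dim X ≤ N`, `ν ≠ Φ^{(N)}` maximal): the cycle invariant
(Cycles file) needs no isolation. [cite: CossartJannsenSaito2020, Rem. 6.29 (1), p. 92, Lemma 5.34 (3), Thm. 3.3] -/
theorem canonicalCentres_general (hRa : OracleAdmissible R) {X : Scheme.{u}} (f : X ⟶ Spec (.of k))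
    [LocallyOfFiniteType f] [QuasiCompact f] [IsReduced X] (hdim : topologicalKrullDim X ≤ (N : WithBot ℕ∞))
    (hmax : Maximal (· ∈ Scheme.hsValues X N) ν) (hν : ν ≠ iterPSum N Phi) (t : CentreSeq X)
    (ht : t.IsCanonicalRun R N ν) : t.AllRegular ∧ t.AllPermissible ∧ t.CentresInStratum N ν :=
  cycleInvariant_runs (k := k) hRa hν ⟨f, ‹_›, ‹_›⟩ ‹_› hdim
    (fun w hw => le_antisymm (hmax.2 ⟨w, rfl⟩ hw) hw) (fun _ => le_rfl) (fun Q hQ => absurd hQ (by simp)) t ht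

/-- **The initial state of `S(X, ν)` is good** for an arbitrary maximal stratum and every admissible oracle.
[folklore] -/
theorem stateGood_init_general (hRa : OracleAdmissible R) {X : Scheme.{u}} (f : X ⟶ Spec (.of k))
    [LocallyOfFiniteType f] [QuasiCompact f] [IsReduced X] (hdim : topologicalKrullDim X ≤ (N : WithBot ℕ∞))
    (hmax : Maximal (· ∈ Scheme.hsValues X N) ν) (hν : ν ≠ iterPSum N Phi) :
    StateGood k R N ν X (Labelling.init X) none :=
  ⟨⟨f, ‹_›, ‹_›⟩, hdim, fun w hw => le_antisymm (hmax.2 ⟨w, rfl⟩ hw) hw,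
    fun t ht => (canonicalCentres_general hRa f hdim hmax hν t ht).2.1⟩

/-! ## Termination and `ν`-modification from the pointwise O2-type statement -/

/-- **NO CLOSED POINT OF `X(ν)` STARTS AN INFINITE NEAR CHAIN + THE ORACLE ANSWERS ON THE STRATA ⇒ `S(X, ν)`
TERMINATES**, for an arbitrary maximal stratum (functional admissible oracle; compactness for arbitrary strata +
liveness). [cite: CossartJannsenSaito2020, Rem. 6.29 (1), p. 107] -/
theorem canonicalSequenceTerminates_of_forall_noNearChain (hRf : OracleFunctional R) (hRa : OracleAdmissible R)
    {X : Scheme.{u}} [IsLocallyNoetherian X] (f : X ⟶ Spec (.of k)) [LocallyOfFiniteType f] [QuasiCompact f]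
    [IsReduced X] (hdim : topologicalKrullDim X ≤ (N : WithBot ℕ∞)) (hmax : Maximal (· ∈ Scheme.hsValues X N) ν)
    (hν : ν ≠ iterPSum N Phi)
    (htotal : ∀ s : CentreSeq X, s.IsCanonicalRun R N ν → ∀ (Z : Set s.top) (hZ : IsClosed Z),
      Z ⊆ Scheme.hsStratum s.top N ν → Z.Nonempty →
        ∃ t, R (Scheme.IdealSheafData.vanishingIdeal ⟨Z, hZ⟩).subscheme t)
    (hno : ∀ x ∈ Scheme.hsStratum X N ν, IsClosed ({x} : Set X) →
      NoNearChainFrom R N ν (MarkedStage.init X x) fun _ => True) :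
    CanonicalSequenceTerminates R N ν X :=
  have hgood := stateGood_init_general (k := k) hRa f hdim hmax hν
  canonicalSequenceTerminates_of_live_of_not_infinite
    (fun s hs hY => exists_isCanonicalRunFrom_succ_of_total StrictTransformClosedImmersion_holds hgood s hs hY
      (htotal s hs))
    (not_canonicalSequenceInfinite_of_forall_noNearChain hRf hgood hno)

/-- **… ⇒ `S(X, ν)` IS A `ν`-ELIMINATION** (CJS Def. 6.14). [cite: CossartJannsenSaito2020, Def. 6.14, Rem. 6.29 (1)] -/
theorem exists_isNuElimination_of_forall_noNearChain (hRf : OracleFunctional R) (hRa : OracleAdmissible R)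
    {X : Scheme.{u}} [IsLocallyNoetherian X] (f : X ⟶ Spec (.of k)) [LocallyOfFiniteType f] [QuasiCompact f]
    [IsReduced X] (hdim : topologicalKrullDim X ≤ (N : WithBot ℕ∞)) (hmax : Maximal (· ∈ Scheme.hsValues X N) ν)
    (hν : ν ≠ iterPSum N Phi)
    (htotal : ∀ s : CentreSeq X, s.IsCanonicalRun R N ν → ∀ (Z : Set s.top) (hZ : IsClosed Z),
      Z ⊆ Scheme.hsStratum s.top N ν → Z.Nonempty →
        ∃ t, R (Scheme.IdealSheafData.vanishingIdeal ⟨Z, hZ⟩).subscheme t)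
    (hno : ∀ x ∈ Scheme.hsStratum X N ν, IsClosed ({x} : Set X) →
      NoNearChainFrom R N ν (MarkedStage.init X x) fun _ => True) :
    ∃ s : CentreSeq X, s.IsCanonicalRun R N ν ∧ s.IsNuElimination N ν :=
  exists_isNuElimination_of_canonicalSequenceTerminates
    (canonicalSequenceTerminates_of_forall_noNearChain hRf hRa f hdim hmax hν htotal hno)
    fun t ht => (canonicalCentres_general hRa f hdim hmax hν t ht).2

/-- **… ⇒ A `ν`-MODIFICATION `TameWild.NuMod X N d ν`**, for an ARBITRARY maximal stratum of a reduced `X` of finite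
type over a field, `dim X ≤ N`, `dim X ≤ d`, `ν ≠ Φ^{(N)}` (universe `0`). Inputs: the pointwise O2-type statement at
the closed points of `X(ν)` and the oracle's answers on the strata. [cite: CossartJannsenSaito2020, Def. 6.14, Rem. 6.29 (1), p. 107] -/
theorem nuMod_of_forall_noNearChain {R : ∀ S : Scheme.{0}, CentreSeq S → Prop} {N : ℕ} {ν : ℕ → ℕ} {k : Type}
    [Field k] (hRf : OracleFunctional R) (hRa : OracleAdmissible R) {X : Scheme.{0}} [IsLocallyNoetherian X]
    (f : X ⟶ Spec (.of k)) [LocallyOfFiniteType f] [QuasiCompact f] [IsReduced X]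
    (hdimN : topologicalKrullDim X ≤ (N : WithBot ℕ∞)) {d : ℕ} (hdimd : topologicalKrullDim X ≤ (d : WithBot ℕ∞))
    (hmax : Maximal (· ∈ Scheme.hsValues X N) ν) (hν : ν ≠ iterPSum N Phi)
    (htotal : ∀ s : CentreSeq X, s.IsCanonicalRun R N ν → ∀ (Z : Set s.top) (hZ : IsClosed Z),
      Z ⊆ Scheme.hsStratum s.top N ν → Z.Nonempty →
        ∃ t, R (Scheme.IdealSheafData.vanishingIdeal ⟨Z, hZ⟩).subscheme t)
    (hno : ∀ x ∈ Scheme.hsStratum X N ν, IsClosed ({x} : Set X) →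
      NoNearChainFrom R N ν (MarkedStage.init X x) fun _ => True) :
    TameWild.NuMod X N d ν := by
  obtain ⟨s, -, hs⟩ := exists_isNuElimination_of_forall_noNearChain hRf hRa f hdimN hmax hν htotal hno
  exact TameWild.nuMod_of_isNuElimination f hdimd hdimN hmax s hs

/-! ## Dimension three: the answers from CJS Thm. 1.2 -/

/-- **(H2) IN DIMENSION THREE, arbitrary stratum**: along every canonical run of `S(X, ν)` (`X` reduced of finite type
over `k`, `dim X ≤ 3`, `dim X ≤ N`, `ν ≠ Φ^{(N)}` maximal), the reduced closed non-empty subsets of the `ν`-strata are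
reduced excellent Noetherian of dimension `≤ 2`, so CJS Thm. 1.2 resolves them and an oracle answering on resolvable
schemes answers. [cite: CossartJannsenSaito2020, Thm. 1.2 (p. 5), Rem. 6.29 (1)] -/
theorem answers_of_dim_le_three_general (hCJS : CossartJannsenSaito2020SequencePermissible.{u})
    (hRa : OracleAdmissible R)
    (hRtot : ∀ S : Scheme.{u}, (∃ t : CentreSeq S, t.AllPermissible ∧ t.CentresOver (Scheme.regularLocus S)ᶜ ∧
      Literature.AlgebraicGeometry.Resolution.Scheme.IsRegular t.top) → ∃ t, R S t)
    {X : Scheme.{u}} [IsLocallyNoetherian X] (f : X ⟶ Spec (.of k)) [LocallyOfFiniteType f] [QuasiCompact f]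
    [IsReduced X] (hdimN : topologicalKrullDim X ≤ (N : WithBot ℕ∞)) (hmax : Maximal (· ∈ Scheme.hsValues X N) ν)
    (hν : ν ≠ iterPSum N Phi) (hdim3 : topologicalKrullDim X ≤ ((3 : ℕ) : WithBot ℕ∞)) (s : CentreSeq X)
    (hs : s.IsCanonicalRun R N ν) (Z : Set s.top) (hZ : IsClosed Z) (hZν : Z ⊆ Scheme.hsStratum s.top N ν)
    (_hne : Z.Nonempty) : ∃ t, R (Scheme.IdealSheafData.vanishingIdeal ⟨Z, hZ⟩).subscheme t := by
  have hgood : StateGood k R N ν X (Labelling.init X) none := stateGood_init_general hRa f hdimN hmax hν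
  obtain ⟨L', P', hg'⟩ := exists_stateGood_top_of_run s.length hgood s hs rfl
  obtain ⟨g, hgft, hgqc⟩ := hg'.overField
  haveI := hgft
  haveI := hgqc
  haveI : IsLocallyNoetherian s.top := hg'.isLocallyNoetherian
  haveI : IsNoetherian s.top := hg'.isNoetherian
  haveI : IsReduced s.top := SigmaMaxModifications.Sketch.isReduced_top s
  have hdim3' : topologicalKrullDim s.top ≤ ((3 : ℕ) : WithBot ℕ∞) := CentreSeq.topologicalKrullDim_top_le s hdim3
  set T := (Scheme.IdealSheafData.vanishingIdeal ⟨Z, hZ⟩ : s.top.IdealSheafData) with hT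
  haveI : IsReduced T.subscheme := ComponentGluing.isReduced_subscheme_vanishingIdeal ⟨Z, hZ⟩
  haveI : IsNoetherian T.subscheme := Scheme.isNoetherian_of_finiteType_over_field (T.subschemeι ≫ g)
  have hexcT : Scheme.IsExcellent T.subscheme :=
    Scheme.isExcellent_of_locallyOfFiniteType Stacks07QW_field_holds (T.subschemeι ≫ g)
  have hdimT : topologicalKrullDim T.subscheme ≤ 2 := by
    rw [hT, topologicalKrullDim_subscheme_vanishingIdeal]
    exact_mod_cast topologicalKrullDim_le_two_of_subset_hsStratum hν hg'.dim_le hdim3' hZ hZν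
  obtain ⟨t, hperm, hsing, hreg⟩ := hCJS T.subscheme hexcT hdimT
  exact hRtot _ ⟨t, hperm, hsing.centresOver, hreg⟩

/-- **THREEFOLDS, arbitrary maximal stratum: pointwise O2 + CJS Thm. 1.2 ⇒ `ν`-modification.** `Y` reduced of finite
type over any field `k`, `dim Y ≤ 3`, `dim Y ≤ N`, `dim Y ≤ d`, `ν ≠ Φ^{(N)}` maximal; `R` a functional admissible oracle
answering on every resolvable scheme (e.g. the choice oracle, `exists_choiceOracle`); if NO closed point of `Y(ν)` starts
an infinite chain of closed near points along `S(Y, ν)`, then `TameWild.NuMod Y N d ν`. No condition on the shape or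
position of `Y(ν)`, on `ν` (tame or wild), or on `k` (perfect or not).
[cite: CossartJannsenSaito2020, Thm. 1.2, Def. 6.14, Rem. 6.29 (1), p. 107] -/
theorem nuMod_threefold_of_forall_noNearChain (hCJS : CossartJannsenSaito2020SequencePermissible.{0})
    {R : ∀ S : Scheme.{0}, CentreSeq S → Prop} {N : ℕ} {ν : ℕ → ℕ} (hRf : OracleFunctional R)
    (hRa : OracleAdmissible R)
    (hRtot : ∀ S : Scheme.{0}, (∃ t : CentreSeq S, t.AllPermissible ∧ t.CentresOver (Scheme.regularLocus S)ᶜ ∧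
      Literature.AlgebraicGeometry.Resolution.Scheme.IsRegular t.top) → ∃ t, R S t)
    {k : Type} [Field k] {Y : Scheme.{0}} [IsLocallyNoetherian Y] (g : Y ⟶ Spec (.of k)) [LocallyOfFiniteType g]
    [QuasiCompact g] [IsReduced Y] (hdim3 : topologicalKrullDim Y ≤ ((3 : ℕ) : WithBot ℕ∞))
    (hdimN : topologicalKrullDim Y ≤ (N : WithBot ℕ∞)) {d : ℕ} (hdimd : topologicalKrullDim Y ≤ (d : WithBot ℕ∞))
    (hmax : Maximal (· ∈ Scheme.hsValues Y N) ν) (hν : ν ≠ iterPSum N Phi)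
    (hno : ∀ y ∈ Scheme.hsStratum Y N ν, IsClosed ({y} : Set Y) →
      NoNearChainFrom R N ν (MarkedStage.init Y y) fun _ => True) :
    TameWild.NuMod Y N d ν :=
  nuMod_of_forall_noNearChain hRf hRa g hdimN hdimd hmax hν
    (fun s hs Z hZ hZν hne => answers_of_dim_le_three_general hCJS hRa hRtot g hdimN hmax hν hdim3 s hs Z hZ hZν hne)
    hno

/-- **THE CALIBRATION STATEMENT FOR CORRIDOR3: modulo CJS Thm. 1.2, the `ν`-modification engine of threefolds IS the
pointwise O2-type termination statement.** If for every functional admissible oracle answering on resolvable schemes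
no closed point of `Y(ν)` starts an infinite chain of closed near points along `S(Y, ν)` — the O2-type statement at
this stratum — then `TameWild.NuMod Y N d ν` (scope as above). This is the conclusion shape of line tame_wild's
`stub_isolatedNu3` / `stub_tameNu3` / `stub_wildNu3` (`NuMod Y 3 3 ν`) with NONE of their regime hypotheses.
[cite: CossartJannsenSaito2020, Thm. 1.2, Def. 6.14, Rem. 6.29 (1), p. 107] -/
theorem nuMod_threefold_of_noNearChains (hCJS : CossartJannsenSaito2020SequencePermissible.{0}) {N : ℕ}
    {ν : ℕ → ℕ} {k : Type} [Field k] {Y : Scheme.{0}} [IsLocallyNoetherian Y] (g : Y ⟶ Spec (.of k))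
    [LocallyOfFiniteType g] [QuasiCompact g] [IsReduced Y] (hdim3 : topologicalKrullDim Y ≤ ((3 : ℕ) : WithBot ℕ∞))
    (hdimN : topologicalKrullDim Y ≤ (N : WithBot ℕ∞)) {d : ℕ} (hdimd : topologicalKrullDim Y ≤ (d : WithBot ℕ∞))
    (hmax : Maximal (· ∈ Scheme.hsValues Y N) ν) (hν : ν ≠ iterPSum N Phi)
    (hO2 : ∀ R : ∀ S : Scheme.{0}, CentreSeq S → Prop, OracleFunctional R → OracleAdmissible R →
      (∀ S : Scheme.{0}, (∃ t : CentreSeq S, t.AllPermissible ∧ t.CentresOver (Scheme.regularLocus S)ᶜ ∧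
        Literature.AlgebraicGeometry.Resolution.Scheme.IsRegular t.top) → ∃ t, R S t) →
      ∀ y ∈ Scheme.hsStratum Y N ν, IsClosed ({y} : Set Y) →
        NoNearChainFrom R N ν (MarkedStage.init Y y) fun _ => True) :
    TameWild.NuMod Y N d ν := by
  obtain ⟨R, hRf, hRa, hRtot⟩ := exists_choiceOracle.{0}
  exact nuMod_threefold_of_forall_noNearChain hCJS hRf hRa hRtot g hdim3 hdimN hdimd hmax hν (hO2 R hRf hRa hRtot)

end CampaignW42

end Summit.ResolutionOfSingularities.ResolutionOfSingularities.Theorems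

end
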